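import Summits.AtomisticToContinuum.Crystallization.Theorems.FrustratedLawDichotomyBumpSF5

/-!
# FrustratedLawDichotomy · an EXPLICIT radial dominator `kappa6` for the RANGE-6 Schur floor
# `SF₆ = SchurFloor (cutWeight smoothstep₂ 4 6) omega₂ (13/8000)`: everything but ONE near-field inequality on `(4, 7]`

Range-6 twin of hand-1 g13's `…BumpKappaFive` (decomp-a2c, prover hand 2, generation 19; design memo HOME/decomp-a2c-hand-2/g19/RANGE6-DESIGN.md).
Cut `w₆ = cutWeight smoothstep₂ 4 6` (quintic over `[4, 6]`), bump radius `a = 1` (kernel `omega₂`, tail constant `M₅ = (32π/105)²` unchanged),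
dominator `kappa6 s = (max s 1)⁻⁶/(6M₅)·clamp(5s/2 − 23/2, 0, 1)` (Lennard-Jones tail switched on linearly across `[23/5, 5]`):
continuity / sign / tail, `∫_{s>0} s²·kappa6 = (6M₅)⁻¹·8/2645` EXACT, ★ `budget_kappa6 : 4π(∫ s²κ)·256π/3465 ≤ 13/8000` (value `28/17457 = 1.6039·10⁻³`,
`π` cancels), `sf₆_of_nearCert` (the generic `schurFloor_of_radialCert_finite` at `a = 1`, `w = w₆`, `A = 13/8000`), ★★ `sf₆_of_nearIneq6`:
`SF₆ ⟸` ONE inequality on `r ∈ (4, 7]` (numeric margin of the un-weakened inequality `4.7 %` at `r ≈ 5.40`).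
The range-6 data are written as literal terms (no `w₆`/`SF₆` definitions), matching `…CollarCensusZeroRangeCut.…_range6`'s hypothesis.
[folklore]; 0 sorry.  `--supports stmt-AtomisticToContinuum-27623`.
-/

noncomputable section

namespace Summit.AtomisticToContinuum.Crystallization.Theorems.FrustratedLawDichotomyBumpAutocorrelation

open MeasureTheory Set Real
open scoped BigOperators
open Summit.AtomisticToContinuum.Crystallization.Theorems.FrustratedLawDichotomySchurCut
  (omega₂ SchurFloor tailPot cutWeight smoothstep₂ omega₂_of_two_le)

/-! ## §1. The explicit dominator `kappa6` (Lennard-Jones tail `s⁻⁶/(6M₅)` switched on linearly across `[23/5, 5]`) -/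

/-- The linear switch `ramp6 s = clamp(5s/2 − 23/2, 0, 1)` (`0` below `23/5`, `1` above `5`). -/
def ramp6 (s : ℝ) : ℝ := max 0 (min 1 (5 / 2 * s - 23 / 2))

/-- **The explicit range-6 dominator** `kappa6 s = (max s 1)⁻⁶/(6M₅)·ramp6(s)` (`= s⁻⁶/(6M₅)` for `s ≥ 5`, `= 0` for `s ≤ 23/5`). -/
def kappa6 (s : ℝ) : ℝ := (6 * tailConst5)⁻¹ * ((max s 1)⁻¹) ^ 6 * ramp6 s

/-- `ramp6` is continuous. [folklore] -/
theorem continuous_ramp6 : Continuous ramp6 := by unfold ramp6; fun_prop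

/-- `0 ≤ ramp6 s ≤ 1`. [folklore] -/
theorem ramp6_mem_Icc (s : ℝ) : ramp6 s ∈ Icc (0:ℝ) 1 :=
  ⟨le_max_left _ _, max_le zero_le_one (min_le_left _ _)⟩

/-- `ramp6 s = 0` for `s ≤ 23/5`. [folklore] -/
theorem ramp6_of_le {s : ℝ} (h : s ≤ 23 / 5) : ramp6 s = 0 := by
  unfold ramp6
  rw [max_eq_left]
  exact min_le_of_right_le (by linarith)

/-- `ramp6 s = 1` for `5 ≤ s`. [folklore] -/
theorem ramp6_of_ge {s : ℝ} (h : 5 ≤ s) : ramp6 s = 1 := by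
  unfold ramp6
  rw [min_eq_left (by linarith), max_eq_right zero_le_one]

/-- `ramp6 s = 5s/2 − 23/2` on `[23/5, 5]`. [folklore] -/
theorem ramp6_of_mem {s : ℝ} (h1 : 23 / 5 ≤ s) (h2 : s ≤ 5) : ramp6 s = 5 / 2 * s - 23 / 2 := by
  unfold ramp6
  rw [min_eq_right (by linarith), max_eq_right (by linarith)]

/-- `kappa6` is continuous. [folklore] -/
theorem continuous_kappa6 : Continuous kappa6 := by
  unfold kappa6
  refine (continuous_const.mul ((Continuous.inv₀ (by fun_prop) fun s => ?_).pow 6)).mul continuous_ramp6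
  exact ne_of_gt (lt_of_lt_of_le zero_lt_one (le_max_right s 1))

/-- `0 ≤ kappa6`. [folklore] -/
theorem kappa6_nonneg (s : ℝ) : 0 ≤ kappa6 s := by
  unfold kappa6
  refine mul_nonneg (mul_nonneg (inv_nonneg.2 (by linarith [tailConst5_pos])) (pow_nonneg (inv_nonneg.2 ?_) 6)) (ramp6_mem_Icc s).1
  exact le_trans zero_le_one (le_max_right s 1)

/-- `kappa6 s = 0` for `s ≤ 23/5`. [folklore] -/
theorem kappa6_of_le {s : ℝ} (h : s ≤ 23 / 5) : kappa6 s = 0 := by simp [kappa6, ramp6_of_le h]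

/-- The tail: `kappa6 s = (6M₅)⁻¹·s⁻⁶` for `s ≥ 5`. [folklore] -/
theorem kappa6_tail {s : ℝ} (h : 5 ≤ s) : kappa6 s = (6 * (32 * π / 105) ^ 2)⁻¹ * (s⁻¹) ^ 6 := by
  rw [kappa6, ramp6_of_ge h, max_eq_left (by linarith), mul_one, tailConst5]

/-- On `[23/5, 5]`: `s²·kappa6 s = (6M₅)⁻¹·((5/2)s⁻³ − (23/2)s⁻⁴)`. [folklore] -/
theorem sq_mul_kappa6_of_mem {s : ℝ} (h1 : 23 / 5 ≤ s) (h2 : s ≤ 5) :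
    s ^ 2 * kappa6 s = (6 * tailConst5)⁻¹ * (5 / 2 * s ^ (-3 : ℤ) - 23 / 2 * s ^ (-4 : ℤ)) := by
  have hs : 0 < s := by linarith
  rw [kappa6, ramp6_of_mem h1 h2, max_eq_left (by linarith), show (-3 : ℤ) = -((3 : ℕ) : ℤ) by norm_num,
    show (-4 : ℤ) = -((4 : ℕ) : ℤ) by norm_num, zpow_neg, zpow_neg, zpow_natCast, zpow_natCast]
  field_simp

/-- On `[5, ∞)`: `s²·kappa6 s = (6M₅)⁻¹·s^(−4)` (real power). [folklore] -/
theorem sq_mul_kappa6_of_ge {s : ℝ} (h : 5 ≤ s) : s ^ 2 * kappa6 s = (6 * tailConst5)⁻¹ * s ^ (-4 : ℝ) := by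
  have hs : 0 < s := by linarith
  rw [kappa6, ramp6_of_ge h, max_eq_left (by linarith), mul_one,
    show (-4 : ℝ) = -((4 : ℕ) : ℝ) by norm_num, Real.rpow_neg hs.le, Real.rpow_natCast]
  field_simp

/-! ## §2. The `L¹` budget of `kappa6`: an exact rational computation (π cancels) -/

/-- The finite part: `∫_{23/5}^{5} s²·kappa6 = (6M₅)⁻¹ · 71/198375`. [folklore] -/
theorem integral_sq_kappa6_mid :
    ∫ s in (23 / 5 : ℝ)..5, s ^ 2 * kappa6 s = (6 * tailConst5)⁻¹ * (71 / 198375) := by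
  have hle : (23 / 5 : ℝ) ≤ 5 := by norm_num
  rw [intervalIntegral.integral_congr (g := fun s => (6 * tailConst5)⁻¹ * (5 / 2 * s ^ (-3 : ℤ) - 23 / 2 * s ^ (-4 : ℤ))) (fun s hs => by
    rw [uIcc_of_le hle] at hs; exact sq_mul_kappa6_of_mem hs.1 hs.2)]
  rw [intervalIntegral.integral_const_mul]
  congr 1
  have hderiv : ∀ s ∈ uIcc (23 / 5 : ℝ) 5,
      HasDerivAt (fun s : ℝ => -(5 / 4) * s ^ (-2 : ℤ) + 23 / 6 * s ^ (-3 : ℤ)) (5 / 2 * s ^ (-3 : ℤ) - 23 / 2 * s ^ (-4 : ℤ)) s := by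
    intro s hs
    rw [uIcc_of_le hle] at hs
    have hs0 : s ≠ 0 := by intro h; rw [h] at hs; norm_num at hs
    have h := ((hasDerivAt_zpow (-2) s (Or.inl hs0)).const_mul (-(5 / 4 : ℝ))).add ((hasDerivAt_zpow (-3) s (Or.inl hs0)).const_mul (23 / 6))
    refine h.congr_deriv ?_
    push_cast
    norm_num
    ring
  have hcont : ContinuousOn (fun s : ℝ => 5 / 2 * s ^ (-3 : ℤ) - 23 / 2 * s ^ (-4 : ℤ)) (uIcc (23 / 5 : ℝ) 5) := by
    rw [uIcc_of_le hle]
    have hne : ∀ x ∈ Icc (23 / 5 : ℝ) 5, x ≠ 0 := fun x hx h0 => by rw [h0] at hx; norm_num at hx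
    exact (continuousOn_const.mul (continuousOn_id.zpow₀ (-3) fun x hx => Or.inl (hne x hx))).sub
      (continuousOn_const.mul (continuousOn_id.zpow₀ (-4) fun x hx => Or.inl (hne x hx)))
  rw [intervalIntegral.integral_eq_sub_of_hasDerivAt hderiv (hcont.intervalIntegrable)]
  simp only [zpow_neg, zpow_ofNat]
  norm_num

/-- The tail part: `∫_{5}^∞ s²·kappa6 = (6M₅)⁻¹ · 1/375`. [folklore] -/
theorem integral_sq_kappa6_tail : ∫ s in Ioi (5 : ℝ), s ^ 2 * kappa6 s = (6 * tailConst5)⁻¹ * (1 / 375) := by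
  rw [setIntegral_congr_fun measurableSet_Ioi (fun s (hs : (5:ℝ) < s) => sq_mul_kappa6_of_ge hs.le), integral_const_mul,
    integral_Ioi_rpow_of_lt (by norm_num) (by norm_num)]
  congr 1
  rw [show (-4 : ℝ) + 1 = -((3 : ℕ) : ℝ) by norm_num, Real.rpow_neg (by norm_num), Real.rpow_natCast]
  norm_num

/-- `s²·kappa6` is integrable on `(0, ∞)`. [folklore] -/
theorem integrableOn_sq_kappa6 : IntegrableOn (fun s => s ^ 2 * kappa6 s) (Ioi 0) := by
  have h1 : IntegrableOn (fun s => s ^ 2 * kappa6 s) (Icc 0 5) :=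
    ((continuous_pow 2).mul continuous_kappa6).continuousOn.integrableOn_Icc
  have h2 : IntegrableOn (fun s => s ^ 2 * kappa6 s) (Ioi 5) := by
    have h2' : IntegrableOn (fun s : ℝ => (6 * tailConst5)⁻¹ * s ^ (-4 : ℝ)) (Ioi 5) :=
      (integrableOn_Ioi_rpow_of_lt (by norm_num : (-4:ℝ) < -1) (by norm_num : (0:ℝ) < 5)).const_mul (6 * tailConst5)⁻¹
    exact IntegrableOn.congr_fun h2' (fun s (hs : (5:ℝ) < s) => (sq_mul_kappa6_of_ge hs.le).symm) measurableSet_Ioi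
  exact (h1.union h2).mono_set fun s (hs : 0 < s) => by
    rcases le_or_gt s 5 with h | h
    · exact Or.inl ⟨hs.le, h⟩
    · exact Or.inr h

/-- `∫_{s>0} s²·kappa6 = (6M₅)⁻¹ · 8/2645`. [folklore] -/
theorem integral_sq_kappa6 : ∫ s in Ioi (0:ℝ), s ^ 2 * kappa6 s = (6 * tailConst5)⁻¹ * (8 / 2645) := by
  rw [setIntegral_eq_of_subset_of_forall_sdiff_eq_zero measurableSet_Ioi (Ioi_subset_Ioi (by norm_num) : Ioi (23/5:ℝ) ⊆ Ioi 0)]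
  swap
  · rintro s ⟨-, h2⟩
    have : s ≤ 23 / 5 := not_lt.mp h2
    simp [kappa6_of_le this]
  rw [← Ioc_union_Ioi_eq_Ioi (by norm_num : (23/5:ℝ) ≤ 5),
    setIntegral_union Ioc_disjoint_Ioi_same measurableSet_Ioi
      (integrableOn_sq_kappa6.mono_set fun s hs => lt_trans (by norm_num) hs.1)
      (integrableOn_sq_kappa6.mono_set fun s (hs : (5:ℝ) < s) => lt_trans (by norm_num) hs),
    ← intervalIntegral.integral_of_le (by norm_num : (23/5:ℝ) ≤ 5), integral_sq_kappa6_mid, integral_sq_kappa6_tail, ← mul_add]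
  norm_num

/-- ★ **THE BUDGET OF `kappa6`**: `4π·(∫_{s>0} s²κ)·256π/3465 ≤ 13/8000` (`π` cancels; the value is `28/17457 = 1.6039·10⁻³`). [folklore] -/
theorem budget_kappa6 : 4 * π * (∫ s in Ioi (0:ℝ), s ^ 2 * kappa6 s) * (256 * π / 3465) ≤ 13 / 8000 := by
  rw [integral_sq_kappa6, tailConst5]
  have hπ : π ≠ 0 := Real.pi_ne_zero
  rw [show 4 * π * ((6 * (32 * π / 105) ^ 2)⁻¹ * (8 / 2645)) * (256 * π / 3465) =
      4 * ((6 * (32 / 105 : ℝ) ^ 2)⁻¹ * (8 / 2645)) * (256 / 3465) by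
    field_simp]
  norm_num

/-! ## §3. The range-6 tail weight `cutWeight smoothstep₂ 4 6` (literal; no new definition) -/

/-- Below the window the range-6 tail weight vanishes. [folklore] -/
theorem w6_eq_zero {r : ℝ} (h : r ≤ 4) : cutWeight smoothstep₂ 4 6 r = 0 := by
  have hx : (r - 4) / (6 - 4) ≤ 0 := div_nonpos_of_nonpos_of_nonneg (by linarith) (by norm_num)
  simp [cutWeight, smoothstep₂, hx]

/-- `cutWeight smoothstep₂ 4 6 0 = 0`. [folklore] -/
theorem w6_zero : cutWeight smoothstep₂ 4 6 0 = 0 := w6_eq_zero (by norm_num)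

/-- The range-6 tail weight takes values in `[0, 1]`. [folklore] -/
theorem w6_mem_Icc (r : ℝ) : cutWeight smoothstep₂ 4 6 r ∈ Icc (0:ℝ) 1 := smoothstep₂_mem_Icc _

/-! ## §4. `SF₆` from a near-field certificate, and from ONE near-field inequality -/

/-- ★ **`SF₆` FROM A NEAR-FIELD CERTIFICATE** (`a = 1`, `A = 13/8000`, `w = cutWeight smoothstep₂ 4 6`, tail constant `M = (32π/105)²`, tail from
`R₁ − 2`, `R₁ > 2`; near field `4 < r ≤ R₁`): the generic `schurFloor_of_radialCert_finite` at the range-6 data. [folklore chaining] -/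
theorem sf₆_of_nearCert (κ : ℝ → ℝ) (hκc : Continuous κ) (hκ0 : ∀ s, 0 ≤ κ s) (hκi : IntegrableOn (fun s => s ^ 2 * κ s) (Ioi 0))
    (R₁ : ℝ) (hR₁ : 2 < R₁)
    (htail : ∀ s, R₁ - 2 ≤ s → κ s = (6 * (32 * π / 105) ^ 2)⁻¹ * (s⁻¹) ^ 6)
    (hnear : ∀ r, 4 < r → r ≤ R₁ → -(tailPot (cutWeight smoothstep₂ 4 6) r) ≤
      512 * π / 3465 * (2 * π / r * ∫ s in Ioi 0, s * κ s * ∫ τ in |r - s|..(r + s), τ * omega₂ τ))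
    (hA : 4 * π * (∫ s in Ioi 0, s ^ 2 * κ s) * (256 * π / 3465) ≤ 13 / 8000) :
    SchurFloor (cutWeight smoothstep₂ 4 6) omega₂ (13 / 8000) := by
  have hM : 0 < (32 * π / 105) ^ 2 := by positivity
  have hω : (fun r => omega₂ (r / 1)) = omega₂ := by funext r; simp
  have h := schurFloor_of_radialCert_finite one_pos (cutWeight smoothstep₂ 4 6) w6_zero κ hκc hκ0 hκi R₁ (by linarith)
    (fun r hr hle => ?_) (fun r hr => ?_) ?_ (A := 13 / 8000) (by simpa using hA)
  · rw [hω] at h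
    exact h
  · rcases le_or_gt r 4 with h4 | h4
    · have h0 : tailPot (cutWeight smoothstep₂ 4 6) r = 0 := by simp [tailPot, w6_eq_zero h4]
      rw [h0, neg_zero]
      have := radialCert_nonneg one_pos κ hκ0 hr
      simpa using this
    · simpa using hnear r h4 hle
  · have hr0 : 0 < r := by linarith
    refine (neg_tailPot_le (w6_mem_Icc r) hr0).trans (le_of_eq ?_)
    rw [htail r (by linarith)]
    field_simp
  · have hc := convexOn_tail (le_of_lt (by positivity : (0:ℝ) < (6 * (32 * π / 105) ^ 2)⁻¹)) (by linarith : (0:ℝ) < R₁ - 2) κ htail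
    rwa [show R₁ - 2 * (1 : ℝ) = R₁ - 2 by ring]

/-- ★★ **`SF₆` ⟸ ONE ONE-VARIABLE INEQUALITY ON `(4, 7]`** (explicit dominator `kappa6`; every other hypothesis of `sf₆_of_nearCert` discharged).
[folklore chaining] -/
theorem sf₆_of_nearIneq6
    (hnear : ∀ r, 4 < r → r ≤ 7 → -(tailPot (cutWeight smoothstep₂ 4 6) r) ≤
      512 * π / 3465 * (2 * π / r * ∫ s in Ioi 0, s * kappa6 s * ∫ τ in |r - s|..(r + s), τ * omega₂ τ)) :
    SchurFloor (cutWeight smoothstep₂ 4 6) omega₂ (13 / 8000) :=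
  sf₆_of_nearCert kappa6 continuous_kappa6 kappa6_nonneg integrableOn_sq_kappa6 7 (by norm_num)
    (fun s hs => kappa6_tail (by linarith)) hnear budget_kappa6

end Summit.AtomisticToContinuum.Crystallization.Theorems.FrustratedLawDichotomyBumpAutocorrelation

end
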